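import Summits.Ventures.HSemireg.EmbeddedFirstOrderDeformationsCechNonzeroClass

/-!
# Venture HSemireg — the `(−1)`-curve DOES lift: on `𝒪_{ℙ¹}(−1)` the same shear `s⁻¹∂/∂p` has a VANISHING Čech
# class (`H¹(ℙ¹, 𝒪(−1)) = 0`), so the obstruction of `…CechMinusTwoCurve` is a genuine `(−2)` phenomenon

HONEST FRAMING.  Lean side of the computation cell `pub-hsemireg` (track «S4-PUSH» (ii), seat s4-prove-3 g6, second
route for (S5)); log `s4push/prove-3/ATTEMPT-10.md` §5g.  The threshold companion of `…CechMinusTwoCurve`: the SAME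
charts `k[s,p]`, `k[t,q]`, overlap `k[s,s⁻¹,p]` and twist `θ = s⁻¹∂/∂p`, but gluing `t = s⁻¹`, `q = s·p` (the total
space of `𝒪_{ℙ¹}(−1)`, the blow-up of a point) — and now the zero section LIFTS, with the explicit coboundary
`φ₀ = 0`, `φ₁ = (q ↦ 1)`: `θ̄(p) = s⁻¹ = φ₁|(p) − φ₀|(p)` because `φ₁|(sp) = 1`.  Plain commutative algebra; no Mathlib
scheme, sheaf, abelian variety or semiregularity map; nothing here says that HC, HC_CM or HC_AV holds; no object is
certified; no Literature fact is declared.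

WHAT (namespace `Summit.Ventures.HSemireg.EmbeddedDeformation.DoubledLine`):
* §1 `unitNormal α : (p) →ₗ k[s,p]/(p)`, `c·p ↦ c̄` — the normal vector field «`1`» on a principal ideal generated by
  a non-zero-divisor (`coeffX1`, by `MvPolynomial.isRegular_X`); `unitNormal_apply_X_one`.
* §2 the `(−1)` coordinate change `psi1 : L ≃+* L` (`s ↦ s⁻¹`, `p ↦ sp`, an involution), chart maps `resM1`,
  `preservesLifts_resM1`, `thickenedAtlas_minusOne` (as in `…CechMinusTwoCurve`).
* §3 **`exists_isAtlasLift_minusOne`** — the zero section of `𝒪_{ℙ¹}(−1)` LIFTS to the deformation glued by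
  `q = sp + εs` (`exists_isAtlasLift_twisted_iff` with `φ = (0, unitNormal)`; the four coboundary equations are
  checked on the generator `p/1` of `(p)·L`: `ext_of_span_X_one`); `cechCochain_minusOne_coboundary` — hence for
  ANY local lifts the Čech cochain of the `(−1)`-atlas is a coboundary (the class is choice-free).
So for the same twist the `(−1)`-curve lifts and the `(−2)`-curve does not: the non-liftability of
`…CechMinusTwoCurve` is not an artefact of the construction.

References: R. Hartshorne, *Deformation Theory*, GTM 257 (2010), §6 Thm. 6.2 (b) [corpus:
book:springernd-deformation-theory p0054]; `H¹(ℙ¹, 𝒪(−1)) = 0` [folklore].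
-/

namespace Summit.Ventures.HSemireg

namespace EmbeddedDeformation

namespace DoubledLine

open DualNumber TrivSqZeroExt MvPolynomial

universe u

variable (k : Type u) [CommRing k]

/-! ### §1 The normal vector field `1` on the principal ideal `(p)` -/

/-- The coefficient of an element of `(p) ⊂ k[s,p]` on the generator `p`. -/
noncomputable def coeffX1 {α : Fin 2} (x : idealZ k α) : A k :=
  Classical.choose (Ideal.mem_span_singleton'.1 x.2)

/-- `coeffX1 x · p = x`. [folklore] -/
theorem coeffX1_spec {α : Fin 2} (x : idealZ k α) : coeffX1 k x * (X 1 : A k) = x :=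
  Classical.choose_spec (Ideal.mem_span_singleton'.1 x.2)

/-- The coefficient is unique (`p` is a non-zero-divisor of `k[s,p]`). [folklore] -/
theorem coeffX1_eq {α : Fin 2} {x : idealZ k α} {a : A k} (h : a * (X 1 : A k) = x) : coeffX1 k x = a :=
  (MvPolynomial.isRegular_X (n := (1 : Fin 2)) (R := k)).right
    (show coeffX1 k x * (X 1 : A k) = a * X 1 by rw [coeffX1_spec, h])

/-- **The normal vector field `1`**: `c·p ↦ c mod (p)`, an `A`-linear map `(p) → A/(p)`. [folklore] -/
noncomputable def unitNormal (α : Fin 2) : idealZ k α →ₗ[A k] A k ⧸ idealZ k α where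
  toFun x := Ideal.Quotient.mk _ (coeffX1 k x)
  map_add' x y := by
    rw [← map_add, coeffX1_eq k (a := coeffX1 k x + coeffX1 k y)]
    rw [add_mul, coeffX1_spec, coeffX1_spec]
    rfl
  map_smul' c x := by
    have hsm : ∀ c a : A k, c • Ideal.Quotient.mk (idealZ k α) a = Ideal.Quotient.mk (idealZ k α) (c * a) :=
      fun _ _ ↦ rfl
    rw [RingHom.id_apply, hsm, coeffX1_eq k (a := c * coeffX1 k x)]
    rw [mul_assoc, coeffX1_spec]
    rfl

/-- `unitNormal (p) = 1`. [folklore] -/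
theorem unitNormal_apply_X_one (α : Fin 2) (h : (X 1 : A k) ∈ idealZ k α) :
    unitNormal k α ⟨X 1, h⟩ = Ideal.Quotient.mk _ 1 := by
  change Ideal.Quotient.mk _ (coeffX1 k _) = _
  rw [coeffX1_eq k (a := 1) (one_mul _)]

/-- Two `L`-linear maps on `(p)·L` that agree on the generator `p/1` are equal. [folklore] -/
theorem ext_of_span_X_one {α β : Fin 2} {N : Type*} [AddCommGroup N] [Module (L k) N]
    {f g : idealZ₂ k α β →ₗ[L k] N} (hmem : algebraMap (A k) (L k) (X 1) ∈ idealZ₂ k α β)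
    (h : f ⟨algebraMap (A k) (L k) (X 1), hmem⟩ = g ⟨algebraMap (A k) (L k) (X 1), hmem⟩) : f = g := by
  refine LinearMap.ext fun x ↦ ?_
  obtain ⟨x, hx⟩ := x
  have hx' : x ∈ Ideal.span {algebraMap (A k) (L k) (X 1)} := by
    have : idealZ₂ k α β = Ideal.span {algebraMap (A k) (L k) (X 1)} := by
      change (Ideal.span {(X 1 : A k)}).map _ = _
      rw [Ideal.map_span, Set.image_singleton]
    rw [← this]
    exact hx
  obtain ⟨c, rfl⟩ := Ideal.mem_span_singleton'.1 hx'
  have e : (⟨c * algebraMap (A k) (L k) (X 1), hx⟩ : idealZ₂ k α β) =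
      c • (⟨algebraMap (A k) (L k) (X 1), hmem⟩ : idealZ₂ k α β) := Subtype.ext (by rw [Submodule.coe_smul, smul_eq_mul])
  rw [e, map_smul, map_smul, h]

/-! ### §2 The `(−1)` coordinate change `s ↦ s⁻¹, p ↦ sp` and its atlas -/

/-- `k[s,p] → k[s,s⁻¹,p]`, `s ↦ s⁻¹`, `p ↦ sp` (second chart of `𝒪_{ℙ¹}(−1)`: `t = s⁻¹`, `q = sp`). -/
noncomputable def psi1₀ : A k →+* L k :=
  (MvPolynomial.aeval ![IsLocalization.Away.invSelf (X 0 : A k),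
    algebraMap (A k) (L k) (X 0) * algebraMap (A k) (L k) (X 1)]).toRingHom

/-- `psi1₀ s = s⁻¹`. [folklore] -/
theorem psi1₀_X_zero : psi1₀ k (X 0) = IsLocalization.Away.invSelf (X 0 : A k) := by
  rw [psi1₀, AlgHom.toRingHom_eq_coe, AlgHom.coe_toRingHom, MvPolynomial.aeval_X]; rfl

/-- `psi1₀ p = s·p`. [folklore] -/
theorem psi1₀_X_one : psi1₀ k (X 1) = algebraMap (A k) (L k) (X 0) * algebraMap (A k) (L k) (X 1) := by
  rw [psi1₀, AlgHom.toRingHom_eq_coe, AlgHom.coe_toRingHom, MvPolynomial.aeval_X]; rfl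

/-- `psi1₀` on constants. [folklore] -/
theorem psi1₀_C (c : k) : psi1₀ k (C c) = algebraMap (A k) (L k) (C c) := by
  rw [psi1₀, AlgHom.toRingHom_eq_coe, AlgHom.coe_toRingHom, MvPolynomial.algHom_C, ← MvPolynomial.algebraMap_eq]
  exact IsScalarTower.algebraMap_apply k (A k) (L k) c

/-- `psi1₀ s` is a unit. [folklore] -/
theorem isUnit_psi1₀_X_zero : IsUnit (psi1₀ k (X 0)) := by
  rw [psi1₀_X_zero]
  exact IsUnit.of_mul_eq_one_right _ (IsLocalization.Away.mul_invSelf (S := L k) (X 0 : A k))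

/-- The coordinate change extended to `L`. [folklore] -/
noncomputable def psi1Hom : L k →+* L k :=
  IsLocalization.Away.lift (X 0 : A k) (isUnit_psi1₀_X_zero k)

/-- `psi1Hom (a/1) = psi1₀ a`. [folklore] -/
theorem psi1Hom_algebraMap (a : A k) : psi1Hom k (algebraMap (A k) (L k) a) = psi1₀ k a :=
  IsLocalization.Away.lift_eq (X 0 : A k) (isUnit_psi1₀_X_zero k) a

/-- `psi1Hom (s⁻¹) = s`. [folklore] -/
theorem psi1Hom_invSelf : psi1Hom k (IsLocalization.Away.invSelf (X 0 : A k)) = algebraMap (A k) (L k) (X 0) := by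
  have h1 : psi1Hom k (algebraMap (A k) (L k) (X 0)) * psi1Hom k (IsLocalization.Away.invSelf (X 0 : A k)) = 1 := by
    rw [← map_mul, IsLocalization.Away.mul_invSelf, map_one]
  rw [psi1Hom_algebraMap, psi1₀_X_zero] at h1
  have h2 : IsLocalization.Away.invSelf (X 0 : A k) * algebraMap (A k) (L k) (X 0) = 1 := by
    rw [mul_comm, IsLocalization.Away.mul_invSelf]
  calc psi1Hom k (IsLocalization.Away.invSelf (X 0 : A k))
      = (IsLocalization.Away.invSelf (X 0 : A k) * algebraMap (A k) (L k) (X 0)) *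
          psi1Hom k (IsLocalization.Away.invSelf (X 0 : A k)) := by rw [h2, one_mul]
    _ = algebraMap (A k) (L k) (X 0) *
          (IsLocalization.Away.invSelf (X 0 : A k) * psi1Hom k (IsLocalization.Away.invSelf (X 0 : A k))) := by ring
    _ = algebraMap (A k) (L k) (X 0) := by rw [h1, mul_one]

/-- `psi1Hom` is an involution. [folklore] -/
theorem psi1Hom_comp_psi1Hom : (psi1Hom k).comp (psi1Hom k) = RingHom.id (L k) := by
  refine IsLocalization.ringHom_ext (Submonoid.powers (X 0 : A k)) ?_
  refine MvPolynomial.ringHom_ext (fun c ↦ ?_) (fun i ↦ ?_)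
  · simp only [RingHom.comp_apply, RingHom.id_apply, ← MvPolynomial.algebraMap_eq]
    rw [MvPolynomial.algebraMap_eq, psi1Hom_algebraMap, psi1₀_C, psi1Hom_algebraMap, psi1₀_C]
  · simp only [RingHom.comp_apply, RingHom.id_apply]
    fin_cases i
    · simp only [Fin.zero_eta, psi1Hom_algebraMap, psi1₀_X_zero, psi1Hom_invSelf]
    · simp only [Fin.mk_one, psi1Hom_algebraMap, psi1₀_X_one, map_mul, psi1₀_X_zero]
      rw [← mul_assoc, mul_comm (IsLocalization.Away.invSelf _), IsLocalization.Away.mul_invSelf, one_mul]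

/-- The `(−1)` coordinate change as a ring automorphism. [folklore] -/
noncomputable def psi1 : L k ≃+* L k :=
  RingEquiv.ofRingHom (psi1Hom k) (psi1Hom k) (psi1Hom_comp_psi1Hom k) (psi1Hom_comp_psi1Hom k)

/-- The chart maps of `𝒪_{ℙ¹}(−1)` into the overlap. -/
noncomputable def resM1 : Fin 2 → (A k →+* L k) :=
  ![algebraMap (A k) (L k), (psi1 k : L k →+* L k).comp (algebraMap (A k) (L k))]

/-- `resM1 1 = psi1 ∘` localisation. -/
theorem resM1_one : resM1 k 1 = (psi1 k : L k →+* L k).comp (algebraMap (A k) (L k)) := rfl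

/-- `resM1 1 a = psi1Hom (a/1)`. -/
theorem resM1_one_apply (a : A k) : resM1 k 1 a = psi1Hom k (algebraMap (A k) (L k) a) := rfl

/-- `resM1 1 (p) = s·p`. [folklore] -/
theorem resM1_one_X_one : resM1 k 1 (X 1) = algebraMap (A k) (L k) (X 0) * algebraMap (A k) (L k) (X 1) := by
  rw [resM1_one_apply, psi1Hom_algebraMap, psi1₀_X_one]

/-- `(p)·L` is `psi1`-stable. [folklore] -/
theorem map_psi1_idealZ₂ (α β : Fin 2) : (idealZ₂ k α β).map (psi1 k : L k →+* L k) = idealZ₂ k α β := by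
  change ((Ideal.span {(X 1 : A k)}).map _).map _ = (Ideal.span {(X 1 : A k)}).map _
  rw [Ideal.map_map, Ideal.map_span, Ideal.map_span, Set.image_singleton, Set.image_singleton, RingHom.comp_apply]
  change Ideal.span {psi1Hom k _} = _
  rw [psi1Hom_algebraMap, psi1₀_X_one]
  exact Ideal.span_singleton_mul_left_unit (IsLocalization.Away.algebraMap_isUnit (S := L k) (X 0 : A k)) _

/-- Both chart maps carry flat lifts (as in `…CechMinusTwoCurve`). [folklore] -/
theorem preservesLifts_resM1 : ∀ α β : Fin 2,
    PreservesLifts (fstRingHom (A k)) (ε : (A k)[ε]) (fstRingHom (L k)) (ε : (L k)[ε]) (mapRingHom (resM1 k α))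
      (idealZ k α) (idealZ₂ k α β) := by
  intro α β
  fin_cases α
  · exact preservesLifts_mapRingHom_of_isLocalization (Submonoid.powers (X 0 : A k)) _
  · show PreservesLifts _ _ _ _ (mapRingHom (resM1 k 1)) (idealZ k 1) (idealZ₂ k 1 β)
    rw [resM1_one, mapRingHom_comp', ← coe_mapRingEquiv]
    intro K hK
    have h1 := preservesLifts_mapRingHom_of_isLocalization (S := L k) (Submonoid.powers (X 0 : A k)) (idealZ k 1) hK
    have h2 := h1.map_ringEquivPair (τ := fstRingHom (L k)) (e' := (ε : (L k)[ε])) (mapRingEquiv (psi1 k)) (psi1 k)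
      (fun z ↦ by
        show (mapRingHom (psi1 k : L k →+* L k) z).fst = psi1 k z.fst
        exact fst_mapRingHom _ z)
      (by
        show mapRingHom (psi1 k : L k →+* L k) ε = ε
        exact mapRingHom_eps _)
    rw [Ideal.map_map, Ideal.map_map] at h2
    have h3 : (idealZ k 1).map ((psi1 k : L k →+* L k).comp (algebraMap (A k) (L k))) = idealZ₂ k 1 β := by
      rw [← Ideal.map_map]
      exact map_psi1_idealZ₂ k 1 β
    rw [h3] at h2
    exact h2

/-- **The `(−1)`-bundle with the same shear IS a thickened atlas.** [folklore] -/
theorem thickenedAtlas_minusOne :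
    ThickenedAtlas (fun _ : Fin 2 ↦ fstRingHom (A k)) (fun _ ↦ (ε : (A k)[ε])) (fun _ _ ↦ fstRingHom (L k))
      (fun _ _ ↦ (ε : (L k)[ε])) (fun α _ ↦ mapRingHom (resM1 k α)) (fun α _ ↦ resM1 k α)
      (fun α β ↦ (twist (thetaFamily k α β) : (L k)[ε] →+* (L k)[ε]).comp (mapRingHom (resM1 k β)))
      (fun _ β ↦ resM1 k β) (idealZ k) (idealZ₂ k) :=
  thickenedAtlas_twisted (fun α _ ↦ resM1 k α) (fun _ β ↦ resM1 k β) (idealZ k) (idealZ₂ k) (thetaFamily k)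
    (preservesLifts_resM1 k) (fun α β ↦ preservesLifts_resM1 k β α)

/-! ### §3 The zero section of `𝒪_{ℙ¹}(−1)` lifts -/

/-- The restriction of `unitNormal` along the second chart map, evaluated at the generator `p/1`: `s⁻¹`
(since its value at `s·p = resM1 1 (p)` is `1`). [folklore] -/
theorem res_unitNormal_apply {ρ : (A k)[ε] →+* (L k)[ε]} (hρ : IsThickeningHom (fstRingHom (A k)) (ε : (A k)[ε])
      (fstRingHom (L k)) (ε : (L k)[ε]) ρ (resM1 k 1))
    (hP : PreservesLifts (fstRingHom (A k)) (ε : (A k)[ε]) (fstRingHom (L k)) (ε : (L k)[ε]) ρ (idealZ k 1)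
      (idealZ₂ k 0 1))
    {K₀ : Ideal (A k)[ε]} (h₀ : IsLift (fstRingHom (A k)) (ε : (A k)[ε]) (idealZ k 1) K₀)
    (hmem : algebraMap (A k) (L k) (X 1) ∈ idealZ₂ k 0 1) :
    resNormal (isFirstOrderThickening_dualNumber (A k)) (isFirstOrderThickening_dualNumber (L k)) hP h₀
        (unitNormal k 1) ⟨algebraMap (A k) (L k) (X 1), hmem⟩ =
      Ideal.Quotient.mk (idealZ₂ k 0 1) (IsLocalization.Away.invSelf (X 0 : A k)) := by
  have hX1 : (X 1 : A k) ∈ idealZ k 1 := Ideal.subset_span rfl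
  have hmem₁ : resM1 k 1 (X 1) ∈ idealZ₂ k 0 1 := by
    rw [resM1_one_X_one]
    exact Ideal.mul_mem_left _ _ hmem
  have e1 := resNormal_apply (hT := isFirstOrderThickening_dualNumber (A k))
    (hT' := isFirstOrderThickening_dualNumber (L k)) hρ hP h₀ (unitNormal k 1) ⟨X 1, hX1⟩ 1
    (unitNormal_apply_X_one k 1 hX1).symm hmem₁
  rw [map_one] at e1
  have hx : (⟨resM1 k 1 (X 1), hmem₁⟩ : idealZ₂ k 0 1) =
      algebraMap (A k) (L k) (X 0) • (⟨algebraMap (A k) (L k) (X 1), hmem⟩ : idealZ₂ k 0 1) :=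
    Subtype.ext (by
      show resM1 k 1 (X 1) = algebraMap (A k) (L k) (X 0) • algebraMap (A k) (L k) (X 1)
      rw [resM1_one_X_one, smul_eq_mul])
  rw [hx, map_smul] at e1
  -- `s • v = 1`, hence `v = s⁻¹ • 1`
  have hsm : ∀ c a : L k, c • Ideal.Quotient.mk (idealZ₂ k 0 1) a = Ideal.Quotient.mk (idealZ₂ k 0 1) (c * a) :=
    fun _ _ ↦ rfl
  have key := congrArg (fun v ↦ IsLocalization.Away.invSelf (S := L k) (X 0 : A k) • v) e1
  rw [← mul_smul, mul_comm, IsLocalization.Away.mul_invSelf (S := L k), one_smul] at key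
  rw [key, hsm, mul_one]

/-- **THE (−1)-CURVE LIFTS.**  On the total space of `𝒪_{ℙ¹}(−1)` (charts `k[s,p]`, `k[t,q]`, `t = s⁻¹`, `q = sp`),
deformed to first order by the SAME shear `q = sp + εs`, the zero section `Z` DOES lift: the Čech cochain
`θ̄(p) = s⁻¹` is the coboundary of `φ₀ = 0`, `φ₁ = (q ↦ 1)` since `φ₁|(p) = s⁻¹·φ₁|(sp) = s⁻¹`.  Contrast
`not_exists_isAtlasLift_minusTwo`: with `q = s²p` the same computation needs `s⁻²·(polynomial in s⁻¹) = s⁻¹`,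
impossible — `H¹(𝒪(−1)) = 0` versus `H¹(𝒪(−2)) = k`. [cite: Hartshorne2010, §6 Thm. 6.2 (b)] -/
theorem exists_isAtlasLift_minusOne :
    ∃ K : Fin 2 → Ideal (A k)[ε],
      IsAtlasLift (fun _ : Fin 2 ↦ fstRingHom (A k)) (fun _ ↦ (ε : (A k)[ε])) (fun α _ ↦ mapRingHom (resM1 k α))
        (fun α β ↦ (twist (thetaFamily k α β) : (L k)[ε] →+* (L k)[ε]).comp (mapRingHom (resM1 k β)))
        (idealZ k) K := by
  have 𝔄 := thickenedAtlas_twisted (fun α _ ↦ resM1 k α) (fun _ β ↦ resM1 k β) (idealZ k) (idealZ₂ k)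
    (thetaFamily k) (preservesLifts_resM1 k) (fun α β ↦ preservesLifts_resM1 k β α)
  have hsec := isLift_map_chartSection 𝔄 (fun _ ↦ algebraMap (A k) (A k)[ε]) fun _ ↦ fstRingHom_algebraMap
  refine (exists_isAtlasLift_twisted_iff (fun α _ ↦ resM1 k α) (fun _ β ↦ resM1 k β) (idealZ k) (idealZ₂ k)
    (thetaFamily k) (preservesLifts_resM1 k) (fun α β ↦ preservesLifts_resM1 k β α)).2
    ⟨![0, unitNormal k 1], fun α β ↦ ?_⟩
  have hmem : algebraMap (A k) (L k) (X 1) ∈ idealZ₂ k α β := Ideal.mem_map_of_mem _ (Ideal.subset_span rfl)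
  have hsm : ∀ c a : L k, c • Ideal.Quotient.mk (idealZ₂ k α β) a = Ideal.Quotient.mk (idealZ₂ k α β) (c * a) :=
    fun _ _ ↦ rfl
  refine ext_of_span_X_one k hmem ?_
  rw [derivToNormal_apply, LinearMap.sub_apply]
  fin_cases α <;> fin_cases β
  · -- (0,0): `θ = 0`, both restrictions of `φ₀ = 0`
    show Ideal.Quotient.mk _ (thetaFamily k 0 0 _) = resR 𝔄 hsec 0 0 0 _ - resL 𝔄 hsec 0 0 0 _
    rw [resR, resL, resNormal_zero (𝔄.homr 0 0) (𝔄.liftsr 0 0) (hsec 0), resNormal_zero (𝔄.homl 0 0) (𝔄.liftsl 0 0)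
      (hsec 0), thetaFamily]
    simp
  · -- (0,1): `θ = s⁻¹∂_p`, `φ₁| (p) = s⁻¹`, `φ₀ = 0`
    show Ideal.Quotient.mk _ (thetaFamily k 0 1 _) = resR 𝔄 hsec 0 1 (unitNormal k 1) _ - resL 𝔄 hsec 0 1 0 _
    rw [resR, resL, resNormal_zero (𝔄.homl 0 1) (𝔄.liftsl 0 1) (hsec 0), LinearMap.zero_apply, sub_zero,
      res_unitNormal_apply k (𝔄.homr 0 1) (𝔄.liftsr 0 1) (hsec 1) hmem, thetaFamily_zero_one,
      theta_algebraMap_X_one]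
  · -- (1,0): `θ = −s⁻¹∂_p`, `φ₀ = 0`, `φ₁| (p) = s⁻¹` on the left
    show Ideal.Quotient.mk _ (thetaFamily k 1 0 _) = resR 𝔄 hsec 1 0 0 _ - resL 𝔄 hsec 1 0 (unitNormal k 1) _
    rw [resR, resL, resNormal_zero (𝔄.homr 1 0) (𝔄.liftsr 1 0) (hsec 0), LinearMap.zero_apply, zero_sub,
      res_unitNormal_apply k (𝔄.homl 1 0) (𝔄.liftsl 1 0) (hsec 1) hmem, ← map_neg, thetaFamily]
    simp [theta_algebraMap_X_one]
  · -- (1,1): `θ = 0`, both restrictions of `φ₁` agree at `p`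
    show Ideal.Quotient.mk _ (thetaFamily k 1 1 _) =
      resR 𝔄 hsec 1 1 (unitNormal k 1) _ - resL 𝔄 hsec 1 1 (unitNormal k 1) _
    rw [resR, resL, res_unitNormal_apply k (𝔄.homr 1 1) (𝔄.liftsr 1 1) (hsec 1) hmem,
      res_unitNormal_apply k (𝔄.homl 1 1) (𝔄.liftsl 1 1) (hsec 1) hmem, sub_self, thetaFamily]
    simp

/-- **For ANY local lifts `T_α` of the zero section on the `(−1)`-atlas the Čech cochain IS a coboundary** (the
class is choice-free, `…CechObstruction.exists_isAtlasLift_iff`; contrast `cechCochain_minusTwo_not_coboundary`).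
[cite: Hartshorne2010, §6 Thm. 6.2 (b)] -/
theorem cechCochain_minusOne_coboundary {T : ∀ α : Fin 2, Ideal (A k)[ε]}
    (hT : ∀ α, IsLift (fstRingHom (A k)) (ε : (A k)[ε]) (idealZ k α) (T α)) :
    ∃ φ : ∀ α : Fin 2, idealZ k α →ₗ[A k] A k ⧸ idealZ k α, ∀ α β,
      cechCochain (thickenedAtlas_minusOne k) hT α β =
        resR (thickenedAtlas_minusOne k) hT α β (φ β) - resL (thickenedAtlas_minusOne k) hT α β (φ α) :=
  (exists_isAtlasLift_iff (thickenedAtlas_minusOne k) hT).1 (exists_isAtlasLift_minusOne k)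

end DoubledLine

end EmbeddedDeformation

end Summit.Ventures.HSemireg
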